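import Mathlib
import Summits.KontsevichZagierPeriods.Zeta5Search.ClusterValuation
import Summits.KontsevichZagierPeriods.Zeta5Search.PalindromicClassBounds
import Summits.KontsevichZagierPeriods.Zeta5Search.PalindromicClassBoundsProof
import Summits.KontsevichZagierPeriods.Zeta5Search.CasoratianClassBoundProof
import Summits.KontsevichZagierPeriods.Zeta5Search.DenomLaw.ThresholdModelCensus
import Summits.KontsevichZagierPeriods.Zeta5Search.DenomLaw.ThresholdModelCasoratian

/-!
# ζ(5) search — DENOM-LAW: the threshold model, PART V (the Casoratian on the D region), part B: deep-cell consequences and the PURE cells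

Cell `pub-zeta5`, track DENOM-LAW (K1 typing order item (1), «ThresholdModel port»): denom-engine-d2 g15's kernel-checked scratch module
`denom-law/engine-d2/g15/lean/LevelCensusCasoratian.lean` PART V (THRESHOLD-X7) filed VERBATIM in three parts (≤ 400 lines each) by denom-prover-d1 g5.  Part B of 3.
HONEST FRAMING: systematic search; MODEL-side level combinatorics read against the tree's own `casLB`/`vbMin`/`rowMin` (THEOREM LB) on deep cells; nothing about ζ(5); no γ; no irrationality claim; records in print UNMOVED.
The mathematical header of PART V is the second module docstring of part A (`ThresholdModelCasoratian.lean`).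
-/

namespace Summit.KontsevichZagierPeriods.Zeta5Search.DenomLaw.ThresholdModel.Rho

section Casoratian

open Summit.KontsevichZagierPeriods.Zeta5Search.ClusterValuation (classExp classPoleCount classNu tameSingle vbMin rowMin casLB
  classRowList wLB uLB wLBpal uLBpal casoratianClassBound_holds wLB_le_padicValRat_coeffW uLB_le_padicValRat_coeffU
  vbMin_le_padicValRat_coeffV palindromicClassBoundW_holds palindromicClassBoundU_holds)
open Summit.KontsevichZagierPeriods.Zeta5Search.CasoratianValuation (InPolytope pairFloors refund shift casoratian)
open Summit.KontsevichZagierPeriods.Zeta5Search.WedgeDictionary (dOf coeffW coeffU coeffV)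

namespace DeepCell
variable {p R0 : ℤ} {r : Fin 7 → ℤ}

/-- **`π(ρ)` ON A DEEP CELL**: the anchors `ρ₁ + ρ₅ ≥ 2p` and `ρ₂ + ρ₄ ≥ 2p` (all three deep cases) force every pair with larger
index `≥ 5` (15 pairs) and the pairs `(2,4)`, `(3,4)` to reach `2p`; only the four pairs `(1,2), (1,3), (1,4), (2,3)` are free:
`π = 17 + [ρ₁+ρ₂ ≥ 2p] + [ρ₁+ρ₃ ≥ 2p] + [ρ₁+ρ₄ ≥ 2p] + [ρ₂+ρ₃ ≥ 2p]`. -/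
theorem pairHigh_eq (h : DeepCell p R0 r) :
    pairHigh p r = 17 + indic (2 * p ≤ r 0 + r 1) + indic (2 * p ≤ r 0 + r 2) + indic (2 * p ≤ r 0 + r 3) +
      indic (2 * p ≤ r 1 + r 2) := by
  have h04 := h.two_p_le_r0_add_r4
  have h13 := h.two_p_le_r1_add_r3
  have m01 : r 0 ≤ r 1 := h.r_le (by decide)
  have m12 : r 1 ≤ r 2 := h.r_le (by decide)
  have m23 : r 2 ≤ r 3 := h.r_le (by decide)
  have m34 : r 3 ≤ r 4 := h.r_le (by decide)
  have m45 : r 4 ≤ r 5 := h.r_le (by decide)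
  have m56 : r 5 ≤ r 6 := h.r_le (by decide)
  unfold pairHigh
  simp only [Fin.sum_univ_seven, Fin.lt_def]
  norm_num
  have i04 : indic (2 * p ≤ r 0 + r 4) = 1 := indic_pos h04
  have i05 : indic (2 * p ≤ r 0 + r 5) = 1 := indic_pos (by linarith)
  have i06 : indic (2 * p ≤ r 0 + r 6) = 1 := indic_pos (by linarith)
  have i14 : indic (2 * p ≤ r 1 + r 4) = 1 := indic_pos (by linarith)
  have i15 : indic (2 * p ≤ r 1 + r 5) = 1 := indic_pos (by linarith)
  have i16 : indic (2 * p ≤ r 1 + r 6) = 1 := indic_pos (by linarith)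
  have i24 : indic (2 * p ≤ r 2 + r 4) = 1 := indic_pos (by linarith)
  have i25 : indic (2 * p ≤ r 2 + r 5) = 1 := indic_pos (by linarith)
  have i26 : indic (2 * p ≤ r 2 + r 6) = 1 := indic_pos (by linarith)
  have i34 : indic (2 * p ≤ r 3 + r 4) = 1 := indic_pos (by linarith)
  have i35 : indic (2 * p ≤ r 3 + r 5) = 1 := indic_pos (by linarith)
  have i36 : indic (2 * p ≤ r 3 + r 6) = 1 := indic_pos (by linarith)
  have i45 : indic (2 * p ≤ r 4 + r 5) = 1 := indic_pos (by linarith)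
  have i46 : indic (2 * p ≤ r 4 + r 6) = 1 := indic_pos (by linarith)
  have i56 : indic (2 * p ≤ r 5 + r 6) = 1 := indic_pos (by linarith)
  have i13 : indic (2 * p ≤ r 1 + r 3) = 1 := indic_pos h13
  have i23 : indic (2 * p ≤ r 2 + r 3) = 1 := indic_pos (by linarith)
  linarith

/-- **`17 ≤ π(ρ) ≤ 21`** on a deep cell. -/
theorem pairHigh_bounds (h : DeepCell p R0 r) : 17 ≤ pairHigh p r ∧ pairHigh p r ≤ 21 := by
  rw [h.pairHigh_eq]
  have n01 := indic_nonneg (2 * p ≤ r 0 + r 1)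
  have n02 := indic_nonneg (2 * p ≤ r 0 + r 2)
  have n03 := indic_nonneg (2 * p ≤ r 0 + r 3)
  have n12 := indic_nonneg (2 * p ≤ r 1 + r 2)
  have l01 := indic_le_one (2 * p ≤ r 0 + r 1)
  have l02 := indic_le_one (2 * p ≤ r 0 + r 2)
  have l03 := indic_le_one (2 * p ≤ r 0 + r 3)
  have l12 := indic_le_one (2 * p ≤ r 1 + r 2)
  constructor <;> linarith

/-- `π = 21` as soon as the least pair reaches `2p` (then all do). -/
theorem pairHigh_eq_of_highPair (h : DeepCell p R0 r) (h01 : 2 * p ≤ r 0 + r 1) : pairHigh p r = 21 := by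
  have m01 : r 0 ≤ r 1 := h.r_le (by decide)
  have m12 : r 1 ≤ r 2 := h.r_le (by decide)
  have m23 : r 2 ≤ r 3 := h.r_le (by decide)
  rw [h.pairHigh_eq, indic_pos h01, indic_pos (show 2 * p ≤ r 0 + r 2 by linarith),
    indic_pos (show 2 * p ≤ r 0 + r 3 by linarith), indic_pos (show 2 * p ≤ r 1 + r 2 by linarith)]
  norm_num

/-- `π ≤ 20 ⇒` the least pair is low: `ρ₁ + ρ₂ < 2p`. -/
theorem lowPair_of_pairHigh_le (h : DeepCell p R0 r) (hπ : pairHigh p r ≤ 20) : r 0 + r 1 < 2 * p := by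
  by_contra hc
  have := h.pairHigh_eq_of_highPair (not_lt.1 hc)
  omega

/-- `π = 17 ⇒` the two disjoint pairs `(1,4)`, `(2,3)` are low. -/
theorem twoLowPairs_of_pairHigh_eq (h : DeepCell p R0 r) (hπ : pairHigh p r = 17) :
    r 0 + r 3 < 2 * p ∧ r 1 + r 2 < 2 * p := by
  rw [h.pairHigh_eq] at hπ
  have n01 := indic_nonneg (2 * p ≤ r 0 + r 1)
  have n02 := indic_nonneg (2 * p ≤ r 0 + r 2)
  have n03 := indic_nonneg (2 * p ≤ r 0 + r 3)
  have n12 := indic_nonneg (2 * p ≤ r 1 + r 2)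
  constructor
  · by_contra hc; have := indic_pos (not_lt.1 hc); linarith
  · by_contra hc; have := indic_pos (not_lt.1 hc); linarith

/-- **`π(ρ) + 2·score(u) ≥ 21` FOR EVERY CLASS OF A DEEP CELL, with equality only if `π = 21` and `score(u) = 0`**
(`π = 21`: trivial; `π ≤ 20`: one low pair ⇒ `score ≥ 2` ⇒ `≥ 22`; `π = 17`: two disjoint low pairs ⇒ `score ≥ 4` ⇒ `25`). -/
theorem twentyone_le_pairHigh_add_two_score (h : DeepCell p R0 r) (u : ℤ) :
    21 ≤ pairHigh p r + 2 * score p R0 r u ∧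
      (pairHigh p r + 2 * score p R0 r u = 21 → pairHigh p r = 21 ∧ score p R0 r u = 0) := by
  have hs := score_nonneg p R0 r u
  have hLR := LR_le_score p R0 r u
  obtain ⟨h17, h21⟩ := h.pairHigh_bounds
  by_cases h01 : 2 * p ≤ r 0 + r 1
  · have hπ := h.pairHigh_eq_of_highPair h01
    exact ⟨by linarith, fun he => ⟨hπ, by linarith⟩⟩
  · have h2 := two_le_LR_of_lowPair h.mono (not_le.1 h01) u
    by_cases h17e : pairHigh p r = 17
    · obtain ⟨h03, h12⟩ := h.twoLowPairs_of_pairHigh_eq h17e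
      have h4 := four_le_LR_of_twoLowPairs h.mono h03 h12 u
      exact ⟨by linarith, fun he => by exfalso; linarith⟩
    · exact ⟨by omega, fun he => by exfalso; omega⟩

/-- **`Σ_j ρ_j ≥ 6p + 1`** on a deep cell (`ρ₁+ρ₅ ≥ 2p`, `ρ₂+ρ₄ ≥ 2p`, `ρ₆, ρ₇ ≥ ρ₅ ≥ p`, `ρ₃ ≥ 1`). -/
theorem six_p_lt_sum_r (h : DeepCell p R0 r) : 6 * p + 1 ≤ ∑ j : Fin 7, r j := by
  have h04 := h.two_p_le_r0_add_r4
  have h13 := h.two_p_le_r1_add_r3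
  have h2 := h.one_le_r 2
  have m04 : r 0 ≤ r 4 := h.r_le (by decide)
  have m45 : r 4 ≤ r 5 := h.r_le (by decide)
  have m56 : r 5 ≤ r 6 := h.r_le (by decide)
  simp only [Fin.sum_univ_seven]
  linarith

end DeepCell

/-! ### (X7-9) the PURE cells: where a class of score `0` exists -/

section Pure
variable {p R0 : ℤ} {r : Fin 7 → ℤ}

/-- `#{ρ_j < T} = 0 ⟺ T ≤ ρ₁` for sorted `ρ`. -/
theorem countLt_eq_zero_iff (hr : Monotone r) (T : ℤ) : countLt r T = 0 ↔ T ≤ r 0 := by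
  constructor
  · intro h
    by_contra hc
    have := countLt_ge hr 0 (not_le.1 hc)
    simp at this
    linarith
  · intro h
    have h1 := countLt_le hr 0 h
    have h0 := countLt_nonneg r T
    simp at h1
    linarith

/-- **score `0`**: a class has NO root at `±m/2, ±3m/2` and is off-centre iff `u ∉ {0, p}`, `ρ₁ ≥ p + |u|` and `|u| < 2p − R₀`. -/
theorem score_eq_zero_iff (hr : Monotone r) (u : ℤ) :
    score p R0 r u = 0 ↔
      (u ≠ 0 ∧ u ≠ p ∧ u + p ≤ r 0 ∧ p - u ≤ r 0 ∧ R0 - 2 * p < u ∧ u < 2 * p - R0) := by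
  have hL := countLt_nonneg r (u + p)
  have hR := countLt_nonneg r (p - u)
  have h3 := indic_nonneg (2 * p - R0 ≤ u)
  have h4 := indic_nonneg (u ≤ R0 - 2 * p)
  have h5 := indic_nonneg (u = 0 ∨ u = p)
  unfold score delta L R np nm centre
  constructor
  · intro h
    have eL : countLt r (u + p) = 0 := by linarith
    have eR : countLt r (p - u) = 0 := by linarith
    have e3 : indic (2 * p - R0 ≤ u) = 0 := by linarith
    have e4 : indic (u ≤ R0 - 2 * p) = 0 := by linarith
    have e5 : indic (u = 0 ∨ u = p) = 0 := by linarith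
    rw [countLt_eq_zero_iff hr] at eL eR
    have n3 : ¬ (2 * p - R0 ≤ u) := fun hc => by rw [indic_pos hc] at e3; exact one_ne_zero e3
    have n4 : ¬ (u ≤ R0 - 2 * p) := fun hc => by rw [indic_pos hc] at e4; exact one_ne_zero e4
    have n5 : ¬ (u = 0 ∨ u = p) := fun hc => by rw [indic_pos hc] at e5; exact one_ne_zero e5
    exact ⟨fun h0 => n5 (Or.inl h0), fun hp => n5 (Or.inr hp), eL, eR, not_le.1 n4, not_le.1 n3⟩
  · rintro ⟨h0, hp, hr0, hr0', hlo, hhi⟩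
    rw [(countLt_eq_zero_iff hr _).2 hr0, (countLt_eq_zero_iff hr _).2 hr0', indic_neg (not_le.2 hhi),
      indic_neg (not_le.2 hlo), indic_neg (fun hc => hc.elim h0 hp)]
    norm_num

/-- **THE PURE CELLS, CLOSED FORM**: a deep cell has a class of score `0` (then dominant: no roots at the frame ends, two full
order-6 poles per octave step — the cells where THEOREM LB = (CV) + 13m − 14 exactly) iff
`ρ₁ ≥ p + ε` and `R₀ ≤ 2p − 2 − (ε − 1)`, `ε = 1` for odd `R₀`, `ε = 2` for even `R₀` (witness `u = ε`); in b-coordinates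
`2·b_max ≤ b₀ − m·p − ε`, `b₀ ≤ 3m·p − 1 − ε`. -/
theorem DeepCell.exists_score_zero_iff (h : DeepCell p R0 r) :
    (∃ u, IsClass p R0 u ∧ score p R0 r u = 0) ↔
      (p + 1 + indic (R0 % 2 = 0) ≤ r 0 ∧ R0 + indic (R0 % 2 = 0) ≤ 2 * p - 2) := by
  have hp3 := h.three_le_p
  have hpo := h.odd_p
  constructor
  · rintro ⟨u, ⟨hu1, hu2, hpar⟩, hs⟩
    obtain ⟨h0, hp, a1, a2, hlo, hhi⟩ := (score_eq_zero_iff h.mono u).1 hs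
    by_cases he : R0 % 2 = 0
    · rw [indic_pos he]; constructor <;> omega
    · rw [indic_neg he]; constructor <;> omega
  · rintro ⟨h1, h2⟩
    by_cases he : R0 % 2 = 0
    · rw [indic_pos he] at h1 h2
      refine ⟨2, ⟨by omega, by omega, by omega⟩, (score_eq_zero_iff h.mono 2).2 ⟨by omega, by omega, by omega, by omega, by omega, by omega⟩⟩
    · rw [indic_neg he] at h1 h2
      refine ⟨1, ⟨by omega, by omega, by omega⟩, (score_eq_zero_iff h.mono 1).2 ⟨by omega, by omega, by omega, by omega, by omega, by omega⟩⟩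

/-- a class of score `0` is dominant (scores are `≥ 0`), so then `score_min = 0`. -/
theorem isDominant_of_score_zero {u : ℤ} (hc : IsClass p R0 u) (hs : score p R0 r u = 0) : IsDominant p R0 r u :=
  ⟨hc, fun u' _ => by rw [hs]; exact score_nonneg p R0 r u'⟩

end Pure

end Casoratian

end Summit.KontsevichZagierPeriods.Zeta5Search.DenomLaw.ThresholdModel.Rho
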